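import Summits.Ventures.PercRepro.S1CoreCapEightZero

/-!
# PercRepro — THE EXACT VALUE `Q*(8) = 23`: NO BIG LINE (p1, gen 29)

The sharpening of `S1CoreCapEightZero` from `25` to `23` — the first of the two loose steps of the crude instance
(`proofs/P1-S4-CAPBRIDGE.md` §19, §21). The crude count is loose only when the plane on two meeting lines has
FIVE points, i.e. when no third line meets their union in two points. Two cases: (a) the configuration has a
TRIANGLE (three lines pairwise meeting in three distinct points): the plane on two of its sides contains the third
side, so it has `≥ 6` points, and EightZero's table over `(c, f₀)` restricted to `c ≥ 6` reads `≤ 21`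
(`sum_cap_le_twenty_one_of_triangle`); (b) the configuration is TRIANGLE-FREE: take a point `v` of MAXIMUM
degree `d`; the `d` lines through `v` form a STAR of cost `d + fat U` (`U` its union: each star line is free and
every fat point of `U` is new once), and every other line meets `U` in at most one point (two points would be a
triangle with the two star lines through them), so the other lines are a thin family over `U` with budget
`b = 8 − d − fat U` on free lines and new fat points. The star's cap is `d + fat U + (d − 1)·[v fat]`
(`Seven.sum_fat_sdiff_star_le` over `∅`), the thin family's `≤ b (b + 1)/2 + fat (U ∖ {v}) · b` — the point `v`
lies on NO line of the thin family (`sum_fat_inter_le_of_notMem`, the refinement of `Seven.sum_fat_inter_le`).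
The table over `(d, fat U, [v fat])` reads `≤ 23` (`sum_cap_le_twenty_three_of_no_triangle`; maximum `23` at
`d = 2`, no fat point); a maximum degree `≤ 1` means pairwise disjoint lines (`≤ 8`). Hence
`sum_cap_le_twenty_three_of_no_big`. Axioms: standard.
-/

namespace PercRepro

namespace S1

namespace FourCap

namespace Eight

open Seven

variable {β : Type} [DecidableEq β]

/-- **The fat points of `P₀` on a thin family avoiding a point `v`**: `Σ_{L ∈ T} fat (L ∩ P₀) ≤ fat (P₀ ∖ {v}) · b`
— each fat point of `P₀` other than `v` lies on at most `b` lines of `T`, and `v` on none. -/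
theorem sum_fat_inter_le_of_notMem (w : β → ℕ) (P₀ : Finset β) (T : Finset (Finset β)) {b : ℕ} {v : β}
    (hvT : ∀ L ∈ T, v ∉ L)
    (hT : ∀ L ∈ T, L.card = 3 ∧ (L ∩ P₀).card ≤ 1)
    (hpair : ∀ L ∈ T, ∀ L' ∈ T, L ≠ L' → (L ∩ L').card ≤ 1)
    (hk : ∀ l : List (Finset β), l.Nodup → (∀ L ∈ l, L ∈ T) →
      freeCountR P₀ l + fat w (unionLR P₀ l \ P₀) ≤ b) :
    ∑ L ∈ T, fat w (L ∩ P₀) ≤ fat w (P₀.erase v) * b := by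
  have hline : ∀ L ∈ T, fat w (L ∩ P₀) = ∑ p ∈ P₀.filter (fun u => w u = 2), if p ∈ L then 1 else 0 := by
    intro L _
    unfold fat
    have e : (L ∩ P₀).filter (fun u => w u = 2) = (P₀.filter (fun u => w u = 2)).filter (fun p => p ∈ L) := by
      ext u
      simp only [Finset.mem_filter, Finset.mem_inter]
      tauto
    rw [e, Finset.card_filter]
  rw [Finset.sum_congr rfl hline, Finset.sum_comm]
  have hv0 : (fun p => ∑ L ∈ T, if p ∈ L then 1 else 0) v = 0 := by
    show (∑ L ∈ T, if v ∈ L then 1 else 0) = 0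
    rw [Finset.sum_eq_zero]
    intro L hL
    rw [if_neg (hvT L hL)]
  rw [← Finset.sum_erase (P₀.filter (fun u => w u = 2)) (f := fun p => ∑ L ∈ T, if p ∈ L then 1 else 0)
    (a := v) hv0]
  have hdeg : ∀ p ∈ (P₀.filter (fun u => w u = 2)).erase v, (∑ L ∈ T, if p ∈ L then 1 else 0) ≤ b := by
    intro p _
    rw [← Finset.card_filter]
    exact deg_mem_P₀_le w P₀ T p hT hpair hk
  refine (Finset.sum_le_sum hdeg).trans ?_
  rw [Finset.sum_const_nat (m := b) (fun _ _ => rfl)]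
  unfold fat
  rw [Finset.filter_erase]

section NoBigSharp

variable {w : β → ℕ} {ls : Finset (Finset β)}
  (h1 : ∀ L ∈ ls, ∀ v ∈ L, w v = 1 ∨ w v = 2)
  (h2 : ∀ L ∈ ls, 3 ≤ L.card ∧ wsum w L ≤ 5)
  (h3 : ∀ L ∈ ls, ∀ L' ∈ ls, L ≠ L' → (L ∩ L').card ≤ 1)
  (h4 : ∀ l : List (Finset β), l.Nodup → (∀ L ∈ l, L ∈ ls) → wsum w (unionL l) ≤ 8 + lineRank l)
  (h5 : ∀ l : List (Finset β), l.Nodup → (∀ L ∈ l, L ∈ ls) → lineRank l ≤ 3 → (unionL l).card ≤ 9)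

include h1 h2 h3 h4 h5 in
/-- **No big line, a triangle: cap sum `≤ 21`** — the plane on two sides of a triangle contains the third side,
so it has `≥ 6` points, and the count of `S1CoreCapEightZero` over `(c, f₀)` with `c ≥ 6` reads `≤ 21`. -/
theorem sum_cap_le_twenty_one_of_triangle (hall : ∀ L ∈ ls, L.card = 3)
    {L₁ L₂ L₃ : Finset β} (hL₁ : L₁ ∈ ls) (hL₂ : L₂ ∈ ls) (hL₃ : L₃ ∈ ls) (h21 : L₂ ≠ L₁)
    (h31 : L₃ ≠ L₁) (h32 : L₃ ≠ L₂) (hint : (L₂ ∩ L₁).card = 1) (htri : 2 ≤ (L₃ ∩ (L₂ ∪ L₁)).card) :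
    ∑ L ∈ ls, capPaper L.card (fat w L) ≤ 21 := by
  have h2' := two_le_card_of_spec₇ h2
  obtain ⟨l, hnd, hls, hr, hsub, hmax⟩ := exists_plane ls _ [L₂, L₁] le_rfl (by simp [h21])
    (by simp [hL₁, hL₂]) (by rw [lineRank_pair_eq_three (h2' L₁ hL₁) (h2' L₂ hL₂) hint])
  have hc9 : (unionL l).card ≤ 9 := card_plane_le_nine h5 hnd hls hr
  -- the third side lies in the plane, which therefore has at least six points
  have hU : L₂ ∪ L₁ ⊆ unionL l := by
    intro v hv
    rcases Finset.mem_union.1 hv with h | h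
    · exact mem_unionL_iff.2 ⟨L₂, hsub L₂ (by simp), h⟩
    · exact mem_unionL_iff.2 ⟨L₁, hsub L₁ (by simp), h⟩
  have hL₃l : L₃ ∈ l := by
    by_contra hn
    have h1' := hmax L₃ hL₃ hn
    have h2' : (L₃ ∩ (L₂ ∪ L₁)).card ≤ (L₃ ∩ unionL l).card :=
      Finset.card_le_card (Finset.inter_subset_inter le_rfl hU)
    omega
  have hc6 : 6 ≤ (unionL l).card := by
    have hsub3 : L₃ ∪ (L₂ ∪ L₁) ⊆ unionL l := by
      intro v hv
      rcases Finset.mem_union.1 hv with h | h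
      · exact mem_unionL_iff.2 ⟨L₃, hL₃l, h⟩
      · exact hU h
    have hcU := Finset.card_le_card hsub3
    have hu1 := Finset.card_union_add_card_inter L₂ L₁
    have hu2 := Finset.card_union_add_card_inter L₃ (L₂ ∪ L₁)
    have hi3 : (L₃ ∩ (L₂ ∪ L₁)).card ≤ 2 := by
      have := card_inter_union_le L₃ L₂ L₁
      have := h3 L₃ hL₃ L₂ hL₂ h32
      have := h3 L₃ hL₃ L₁ hL₁ h31
      omega
    have := hall L₁ hL₁
    have := hall L₂ hL₂
    have := hall L₃ hL₃
    omega
  -- inside the plane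
  have hin : 3 * l.length ≤ (unionL l).card.choose 2 := three_mul_length_le_choose_two l hnd
    (fun L hL => hall L (hls L hL)) (fun L hL L' hL' hne => h3 L (hls L hL) L' (hls L' hL') hne)
  have hfatin := sum_fat_plane_le w l (fun L hL => hall L (hls L hL))
    (fun L hL L' hL' hne => h3 L (hls L hL) L' (hls L' hL') hne)
  -- outside the plane: a thin family
  set T := ls.filter (fun L => L ∉ l) with hT
  have hTmem : ∀ L ∈ T, L ∈ ls ∧ L ∉ l := fun L hL => Finset.mem_filter.1 hL
  have hk : ∀ t : List (Finset β), t.Nodup → (∀ L ∈ t, L ∈ T) →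
      freeCountR (unionL l) t + fat w (unionLR (unionL l) t \ unionL l) ≤
        11 - (unionL l).card - fat w (unionL l) := by
    intro t hndt hlt
    have hb := budget_over_plane₈ h1 h2 h4 hr t (by
      rw [List.nodup_append']
      exact ⟨hndt, hnd, fun L hLt hLl => (hTmem L (hlt L hLt)).2 hLl⟩)
      (fun L hL => by
        rcases List.mem_append.1 hL with hL | hL
        · exact (hTmem L (hlt L hL)).1
        · exact hls L hL)
      (fun L hL => hall L (hTmem L (hlt L hL)).1)
    omega
  have hthin := two_mul_sum_cap_thin_le w (unionL l) T
    (fun L hL => ⟨hall L (hTmem L hL).1, hmax L (hTmem L hL).1 (hTmem L hL).2⟩)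
    (fun L hL L' hL' hne => h3 L (hTmem L hL).1 L' (hTmem L' hL').1 hne)
    (fun L hL => h1 L (hTmem L hL).1) (fun L hL => (h2 L (hTmem L hL).1).2) hk
  -- `c + f₀ ≤ 11`
  have hcost : (unionL l).card + fat w (unionL l) ≤ 11 := by
    have := budget_over_plane₈ h1 h2 h4 hr [] (by simpa using hnd) (by simpa using hls) (by simp)
    omega
  -- the split of the sum
  have hsplit := Finset.sum_filter_add_sum_filter_not ls (fun L => L ∈ l) (fun L => capPaper L.card (fat w L))
  have hfil : ls.filter (fun L => L ∈ l) = l.toFinset := by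
    ext L
    simp only [Finset.mem_filter, List.mem_toFinset]
    exact ⟨fun h => h.2, fun h => ⟨hls L h, h⟩⟩
  rw [hfil, ← hT] at hsplit
  rw [← hsplit]
  have hcapl : ∀ L ∈ l.toFinset, capPaper L.card (fat w L) = 1 + fat w L := by
    intro L hL
    have hL' := hls L (List.mem_toFinset.1 hL)
    have := wsum_eq_card_add_fat w L (h1 L hL')
    have := (h2 L hL').2
    have := hall L hL'
    rw [hall L hL', capPaper_three_eq' (by omega)]
  rw [Finset.sum_congr rfl hcapl, Finset.sum_add_distrib, Finset.sum_const_nat (m := 1) (fun _ _ => rfl),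
    List.toFinset_card_of_nodup hnd, Nat.mul_one]
  rw [Nat.choose_two_right] at hin
  -- the table
  generalize hc : (unionL l).card = c at hin hfatin hthin hcost hc6 hc9
  generalize hf : fat w (unionL l) = f₀ at hfatin hthin hcost
  generalize l.length = a at hin ⊢
  generalize ∑ L ∈ l.toFinset, fat w L = b at hfatin ⊢
  generalize ∑ L ∈ T, capPaper L.card (fat w L) = d at hthin ⊢
  have hf5 : f₀ ≤ 5 := by omega
  interval_cases c <;> interval_cases f₀ <;> omega

include h1 h2 h3 h4 in
/-- **No big line, no triangle: cap sum `≤ 23`** — the star at a point of maximum degree `d ≥ 2` costs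
`d + fat U`, every other line is thin over its union `U`, and the table over `(d, fat U, [v fat])` reads `≤ 23`. -/
theorem sum_cap_le_twenty_three_of_no_triangle (hall : ∀ L ∈ ls, L.card = 3)
    (hnt : ∀ L₁ ∈ ls, ∀ L₂ ∈ ls, ∀ L₃ ∈ ls, L₂ ≠ L₁ → L₃ ≠ L₁ → L₃ ≠ L₂ → (L₂ ∩ L₁).card = 1 →
      (L₃ ∩ (L₂ ∪ L₁)).card ≤ 1) :
    ∑ L ∈ ls, capPaper L.card (fat w L) ≤ 23 := by
  rcases Finset.eq_empty_or_nonempty ls with hempty | ⟨L₀, hL₀⟩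
  · subst hempty; simp
  -- a point of maximum degree
  have hVne : (ls.biUnion id).Nonempty := by
    have := (h2 L₀ hL₀).1
    obtain ⟨p, hp⟩ := Finset.card_pos.1 (by omega : 0 < L₀.card)
    exact ⟨p, Finset.mem_biUnion.2 ⟨L₀, hL₀, hp⟩⟩
  obtain ⟨v, -, hvmax⟩ := Finset.exists_max_image (ls.biUnion id) (fun p => (ls.filter (fun L => p ∈ L)).card)
    hVne
  set A := ls.filter (fun L => v ∈ L) with hA
  set T := ls.filter (fun L => v ∉ L) with hT
  have hAmem : ∀ L ∈ A, L ∈ ls ∧ v ∈ L := fun L hL => Finset.mem_filter.1 hL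
  have hTmem : ∀ L ∈ T, L ∈ ls ∧ v ∉ L := fun L hL => Finset.mem_filter.1 hL
  have hdeg : ∀ p ∈ ls.biUnion id, (ls.filter (fun L => p ∈ L)).card ≤ A.card := fun p hp => hvmax p hp
  by_cases hd : A.card ≤ 1
  · -- every point has degree `≤ 1`: the lines are pairwise disjoint
    refine (sum_cap_le_eight_of_pairwise_disjoint h1 h2 h4 hall (fun L hL L' hL' hne => ?_)).trans (by norm_num)
    by_contra hne0
    obtain ⟨p, hp⟩ := Finset.card_pos.1 (Nat.pos_of_ne_zero hne0)
    have hpL := (Finset.mem_inter.1 hp).1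
    have hpL' := (Finset.mem_inter.1 hp).2
    have hpV : p ∈ ls.biUnion id := Finset.mem_biUnion.2 ⟨L, hL, hpL⟩
    have h2le : 2 ≤ (ls.filter (fun L => p ∈ L)).card := by
      have hsub : ({L, L'} : Finset (Finset β)) ⊆ ls.filter (fun L => p ∈ L) := by
        intro X hX
        rcases Finset.mem_insert.1 hX with rfl | hX
        · exact Finset.mem_filter.2 ⟨hL, hpL⟩
        · rw [Finset.mem_singleton.1 hX]; exact Finset.mem_filter.2 ⟨hL', hpL'⟩
      have := Finset.card_le_card hsub
      rw [Finset.card_pair hne] at this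
      exact this
    have := hdeg p hpV
    omega
  push Not at hd
  -- the star at `v`
  have hA3 : ∀ L ∈ A, L.card = 3 := fun L hL => hall L (hAmem L hL).1
  have hAv : ∀ L ∈ A, v ∈ L := fun L hL => (hAmem L hL).2
  have hApair : ∀ L ∈ A, ∀ L' ∈ A, L ≠ L' → (L ∩ L').card ≤ 1 := fun L hL L' hL' hne =>
    h3 L (hAmem L hL).1 L' (hAmem L' hL').1 hne
  have hAne : A.Nonempty := Finset.card_pos.1 (by omega)
  set U := unionL A.toList with hU
  have hUeq : U = A.biUnion id := by
    rw [hU, unionL_eq_biUnion, Finset.toList_toFinset]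
  have hmemU : ∀ {p : β}, p ∈ U ↔ ∃ L ∈ A, p ∈ L := by
    intro p
    rw [hU, mem_unionL_iff]
    simp only [Finset.mem_toList]
  have hvU : v ∈ U := by
    obtain ⟨L, hL⟩ := hAne
    exact hmemU.2 ⟨L, hL, hAv L hL⟩
  -- the rank of the star: `|U| = lineRank + d`
  have hcardU : U.card = lineRank A.toList + A.card := by
    have h := card_unionLR ∅ A.toList (fun L hL => hA3 L (Finset.mem_toList.1 hL))
    rw [unionLR_empty, lineRankR_empty, freeCountR_eq_length_of_mem ∅ (Finset.notMem_empty v) A.toList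
      (Finset.nodup_toList A) (fun L hL => ⟨hA3 L (Finset.mem_toList.1 hL), hAv L (Finset.mem_toList.1 hL),
        by simp⟩) (fun L hL L' hL' hne => hApair L (Finset.mem_toList.1 hL) L' (Finset.mem_toList.1 hL') hne),
      Finset.length_toList, Finset.card_empty] at h
    rw [← hU] at h
    omega
  -- the budget of the thin family over `U`
  have hk : ∀ t : List (Finset β), t.Nodup → (∀ L ∈ t, L ∈ T) →
      freeCountR U t + fat w (unionLR U t \ U) ≤ 8 - A.card - fat w U := by
    intro t hndt hlt
    have hb := freeCountR_add_fat_le h1 h4 A.toList t (by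
      rw [List.nodup_append']
      refine ⟨hndt, Finset.nodup_toList A, fun L hLt hLA => ?_⟩
      exact (hTmem L (hlt L hLt)).2 (hAv L (Finset.mem_toList.1 hLA)))
      (fun L hL => by
        rcases List.mem_append.1 hL with hL | hL
        · exact (hTmem L (hlt L hL)).1
        · exact (hAmem L (Finset.mem_toList.1 hL)).1)
      (fun L hL => hall L (hTmem L (hlt L hL)).1)
    rw [← hU] at hb
    have hsplit := fat_sdiff_add_fat_of_subset w (subset_unionLR U t)
    omega
  have hbudget : A.card + fat w U ≤ 8 := by
    have hb := freeCountR_add_fat_le h1 h4 A.toList [] (by simpa using Finset.nodup_toList A)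
      (fun L hL => (hAmem L (Finset.mem_toList.1 (by simpa using hL))).1) (by simp)
    rw [← hU] at hb
    simp only [freeCountR, unionLR] at hb
    omega
  -- every other line is thin over `U`: two points on `U` would make a triangle with two star lines
  have hTthin : ∀ L ∈ T, (L ∩ U).card ≤ 1 := by
    intro L hL
    obtain ⟨hLls, hvL⟩ := hTmem L hL
    by_contra hc
    push Not at hc
    obtain ⟨a, ha, b, hb, hab⟩ := Finset.one_lt_card.1 hc
    obtain ⟨haL, haU⟩ := Finset.mem_inter.1 ha
    obtain ⟨hbL, hbU⟩ := Finset.mem_inter.1 hb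
    obtain ⟨L₁, hL₁A, haL₁⟩ := hmemU.1 haU
    obtain ⟨L₂, hL₂A, hbL₂⟩ := hmemU.1 hbU
    obtain ⟨hL₁ls, hvL₁⟩ := hAmem L₁ hL₁A
    obtain ⟨hL₂ls, hvL₂⟩ := hAmem L₂ hL₂A
    have hL1 : L ≠ L₁ := fun h => hvL (h ▸ hvL₁)
    have hL2 : L ≠ L₂ := fun h => hvL (h ▸ hvL₂)
    by_cases h12 : L₁ = L₂
    · subst h12
      have : 1 < (L ∩ L₁).card :=
        Finset.one_lt_card.2 ⟨a, Finset.mem_inter.2 ⟨haL, haL₁⟩, b, Finset.mem_inter.2 ⟨hbL, hbL₂⟩, hab⟩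
      have := h3 L hLls L₁ hL₁ls hL1
      omega
    · have hint : (L₂ ∩ L₁).card = 1 := le_antisymm (h3 L₂ hL₂ls L₁ hL₁ls (Ne.symm h12))
        (Finset.card_pos.2 ⟨v, Finset.mem_inter.2 ⟨hvL₂, hvL₁⟩⟩)
      have h1' := hnt L₁ hL₁ls L₂ hL₂ls L hLls (Ne.symm h12) hL1 hL2 hint
      have : 1 < (L ∩ (L₂ ∪ L₁)).card :=
        Finset.one_lt_card.2 ⟨a, Finset.mem_inter.2 ⟨haL, Finset.mem_union_right _ haL₁⟩, b,
          Finset.mem_inter.2 ⟨hbL, Finset.mem_union_left _ hbL₂⟩, hab⟩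
      omega
  -- the cap of the thin family: `2 Σ cap ≤ b (b + 1) + 2 fat (U ∖ {v}) b`
  have hTT : ∀ L ∈ T, L.card = 3 ∧ (L ∩ U).card ≤ 1 := fun L hL => ⟨hall L (hTmem L hL).1, hTthin L hL⟩
  have hTpair : ∀ L ∈ T, ∀ L' ∈ T, L ≠ L' → (L ∩ L').card ≤ 1 := fun L hL L' hL' hne =>
    h3 L (hTmem L hL).1 L' (hTmem L' hL').1 hne
  have hcapT : ∀ L ∈ T, capPaper L.card (fat w L) = (1 + fat w (L \ U)) + fat w (L ∩ U) := by
    intro L hL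
    have hLls := (hTmem L hL).1
    have hw1 := wsum_eq_card_add_fat w L (h1 L hLls)
    have hw5 := (h2 L hLls).2
    have hL3 := hall L hLls
    rw [hL3, capPaper_three_eq' (by omega), fat_eq_fat_sdiff_add_fat_inter w L U]
    ring
  have hthin1 := two_mul_sum_newFat_le w U (8 - A.card - fat w U) (8 - A.card - fat w U) le_rfl T hTT hTpair hk
  have hthin2 := sum_fat_inter_le_of_notMem w U T (v := v) (fun L hL => (hTmem L hL).2) hTT hTpair hk
  have hthin : 2 * ∑ L ∈ T, capPaper L.card (fat w L) ≤
      (8 - A.card - fat w U) * (8 - A.card - fat w U + 1) + 2 * (fat w (U.erase v) * (8 - A.card - fat w U)) := by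
    rw [Finset.sum_congr rfl hcapT, Finset.sum_add_distrib]
    omega
  -- the cap of the star: `d + Σ fat`, with `Σ fat + [v fat] ≤ fat U + d · [v fat]`
  have hstar : ∑ L ∈ A, capPaper L.card (fat w L) = A.card + ∑ L ∈ A, fat w L :=
    sum_cap_eq_card_add_sum_fat' hA3 (fun L hL => h1 L (hAmem L hL).1) (fun L hL => (h2 L (hAmem L hL).1).2)
  have hstarfat := sum_fat_sdiff_star_le w ∅ (Finset.notMem_empty v) A hAne hAv hApair
  simp only [Finset.sdiff_empty] at hstarfat
  rw [← hUeq] at hstarfat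
  have hUv := fat_erase_add w hvU
  -- the split of the sum and the table
  have hsplit := Finset.sum_filter_add_sum_filter_not ls (fun L => v ∈ L) (fun L => capPaper L.card (fat w L))
  rw [← hA, ← hT] at hsplit
  rw [← hsplit, hstar]
  have he : (if w v = 2 then 1 else 0) ≤ 1 := by split_ifs <;> omega
  generalize (if w v = 2 then 1 else 0) = e at hstarfat hUv he
  generalize hdA : A.card = d at hstarfat hthin hbudget hd ⊢
  generalize hfU : fat w U = f at hstarfat hthin hbudget hUv
  generalize fat w (U.erase v) = fe at hthin hUv
  generalize ∑ L ∈ A, fat w L = sA at hstarfat ⊢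
  generalize ∑ L ∈ T, capPaper L.card (fat w L) = sT at hthin ⊢
  have hd8 : d ≤ 8 := by omega
  have hf6 : f ≤ 6 := by omega
  interval_cases d <;> interval_cases f <;> omega

include h1 h2 h3 h4 h5 in
/-- **No big line at nullity `8`: cap sum `≤ 23`** (sharpening `sum_cap_le_twenty_five_of_no_big`): a triangle
gives `≤ 21`, a triangle-free configuration `≤ 23`. -/
theorem sum_cap_le_twenty_three_of_no_big (hall : ∀ L ∈ ls, L.card = 3) :
    ∑ L ∈ ls, capPaper L.card (fat w L) ≤ 23 := by
  by_cases htri : ∃ L₁ ∈ ls, ∃ L₂ ∈ ls, ∃ L₃ ∈ ls, L₂ ≠ L₁ ∧ L₃ ≠ L₁ ∧ L₃ ≠ L₂ ∧ (L₂ ∩ L₁).card = 1 ∧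
      2 ≤ (L₃ ∩ (L₂ ∪ L₁)).card
  · obtain ⟨L₁, hL₁, L₂, hL₂, L₃, hL₃, h21, h31, h32, hint, htri⟩ := htri
    exact (sum_cap_le_twenty_one_of_triangle h1 h2 h3 h4 h5 hall hL₁ hL₂ hL₃ h21 h31 h32 hint htri).trans
      (by norm_num)
  · push Not at htri
    exact sum_cap_le_twenty_three_of_no_triangle h1 h2 h3 h4 hall
      (fun L₁ hL₁ L₂ hL₂ L₃ hL₃ h21 h31 h32 hint => by
        have := htri L₁ hL₁ L₂ hL₂ L₃ hL₃ h21 h31 h32 hint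
        omega)

end NoBigSharp

end Eight

end FourCap

end S1

end PercRepro
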